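import Mathlib
import Summits.Ventures.HodgeRepro2.T5ProfiniteDistributionPadic

/-!
# T5ProfiniteDistributionConvolution — the convolution of measures on a compact abelian group,
and its coordinates: the level-wise GROUP-RING product of `lim_k A[F k]`; the point masses as the
group-ring elements `[x]`

Tier-5 support for route-3's §G (route/T5-CHECK-G-p7.md §3 S5, §21.4): `W[[Γ]] = lim_U W[Γ/U]`
is a RING in print — the inverse limit of the group rings `W[Γ/U]`.  T5AmiceConvolution /
T5AmiceRingEquiv modelled the convolution on `Γ_𝔭 ≅ ℤ_p` and matched it with the product of power
series; T5IwasawaLimitRing matched it with the level-wise group-ring product on `ℤ/p^k`.  This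
file does the group-ring half for ANY compact normed abelian group `X` (`Γ⁻ ≅ ℤ_p^δ` included)
with a presentation by quotient maps that are additive:

* `shift x f := f(x + ·)` and `partialIntegral m₂ f := (x ↦ m₂(f(x + ·)))`, continuous by
  uniform continuity of `f` on the compact `X` (translation-invariant metric);
* `conv m₁ m₂ : C(X, A) →ₗ[A] A`, `(m₁ ∗ m₂)(f) = ∫∫ f(x + y) dm₂(y) dm₁(x)`, bounded by
  `C₁ · C₂` (`norm_conv_le`);
* `levelMul v w k c := Σ_{a ∈ F k} v k a · w k (c − a)` — the group-ring product of `A[F k]`,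
  commutative (`levelMul_comm`);
* **`coord_conv`** — for a presentation whose level maps are additive (`hq`), the coordinates of
  the convolution are the level-wise group-ring products of the coordinates: a translate of a
  fibre indicator is a fibre indicator (`shift_indicatorCM_fiber`), so the partial integral of
  `1_{fiber c}` is `Σ_a coord m₂ k (c − a) · 1_{fiber a}`;
* the instance `coord_conv_product` on `Γ⁻ ≅ ℤ_p^ι` with `padicProductPresentation`, whose level
  maps are additive (`padicProductPresentation_q_add`) — the product of `W[[Γ⁻]]` read level by
  level on `W[(ℤ/p^k)^ι] = W[Γ⁻/p^kΓ⁻]`;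
* the POINT MASSES `dirac x : f ↦ f x` as the group-ring elements `[x]`: **`coord_dirac`** (their
  coordinates are the images of `x` at every level — the print's `Γ ↪ W[[Γ]]`, `γ ↦ [γ]`),
  **`conv_dirac`** (`δ_x ∗ δ_y = δ_{x+y}`, the group law), **`conv_dirac_zero`** (`δ_0` the unit),
  **`coord_dirac_add`** (`[x + y] = [x] ⋆ [y]` level by level).

Associativity and commutativity of `conv` are in T5ProfiniteDistributionAlgebra.  No printed
input is consumed.  §8(d): uses an L-value-free
non-vanishing device: NO.
-/

namespace Summit.Ventures.HodgeRepro2.T5ProfiniteDistributionConvolution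

open Summit.Ventures.HodgeRepro2.T5MeasureSupOnClopens (indicatorCM indicatorCM_apply)
open Summit.Ventures.HodgeRepro2.T5ProfiniteDistribution
open Summit.Ventures.HodgeRepro2.T5ProfiniteDistributionPadic
open Finset

universe u v

section Shift

variable {X : Type u} [NormedAddCommGroup X]
variable {A : Type*} [NormedCommRing A]

/-- The translate `f(x + ·)` of a continuous function. -/
def shift (x : X) (f : C(X, A)) : C(X, A) :=
  f.comp ⟨fun y => x + y, continuous_const.add continuous_id⟩

/-- `shift x f y = f (x + y)`. -/
@[simp] theorem shift_apply (x : X) (f : C(X, A)) (y : X) : shift x f y = f (x + y) := rfl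

/-- Translation is additive in `f`. -/
theorem shift_add (x : X) (f g : C(X, A)) : shift x (f + g) = shift x f + shift x g := by
  ext y; simp

/-- Translation is `A`-linear in `f`. -/
theorem shift_smul (x : X) (c : A) (f : C(X, A)) : shift x (c • f) = c • shift x f := by
  ext y; simp

variable [CompactSpace X]

/-- `x ↦ f(x + ·)` is continuous `X → C(X, A)`: uniform continuity of `f` on the compact `X` and
translation invariance of the metric. -/
theorem continuous_shift (f : C(X, A)) : Continuous fun x : X => shift x f := by
  rw [Metric.continuous_iff]
  intro x ε hε
  obtain ⟨δ, hδ, hf⟩ := Metric.uniformContinuous_iff.1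
    (CompactSpace.uniformContinuous_of_continuous f.continuous) (ε / 2) (half_pos hε)
  refine ⟨δ, hδ, fun x' hx' => ?_⟩
  refine lt_of_le_of_lt ((ContinuousMap.dist_le (half_pos hε).le).2 fun y => ?_) (half_lt_self hε)
  simp only [shift_apply]
  exact (hf (by rwa [dist_add_right])).le

/-- The partial integral `x ↦ ∫ f(x + y) dm₂(y)`, a continuous function of `x` for a bounded `m₂`. -/
noncomputable def partialIntegral (m₂ : C(X, A) →ₗ[A] A) {C₂ : ℝ}
    (hm₂ : ∀ φ : C(X, A), ‖m₂ φ‖ ≤ C₂ * ‖φ‖) (f : C(X, A)) : C(X, A) :=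
  ⟨fun x => m₂ (shift x f),
    (AddMonoidHomClass.continuous_of_bound m₂ C₂ hm₂).comp (continuous_shift f)⟩

/-- `partialIntegral m₂ hm₂ f x = m₂ (shift x f)`. -/
@[simp] theorem partialIntegral_apply (m₂ : C(X, A) →ₗ[A] A) {C₂ : ℝ}
    (hm₂ : ∀ φ : C(X, A), ‖m₂ φ‖ ≤ C₂ * ‖φ‖) (f : C(X, A)) (x : X) :
    partialIntegral m₂ hm₂ f x = m₂ (shift x f) := rfl

/-- THE CONVOLUTION `(m₁ ∗ m₂)(f) = ∫∫ f(x + y) dm₂(y) dm₁(x)`. -/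
noncomputable def conv (m₁ m₂ : C(X, A) →ₗ[A] A) {C₂ : ℝ}
    (hm₂ : ∀ φ : C(X, A), ‖m₂ φ‖ ≤ C₂ * ‖φ‖) : C(X, A) →ₗ[A] A where
  toFun f := m₁ (partialIntegral m₂ hm₂ f)
  map_add' f g := by
    rw [← map_add]
    congr 1
    ext x
    simp only [partialIntegral_apply, shift_add, map_add, ContinuousMap.add_apply]
  map_smul' c f := by
    rw [RingHom.id_apply, ← map_smul]
    congr 1
    ext x
    simp only [partialIntegral_apply, shift_smul, map_smul, ContinuousMap.smul_apply]

/-- `conv m₁ m₂ hm₂ f = m₁ (x ↦ m₂ (f(x + ·)))`. -/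
theorem conv_apply (m₁ m₂ : C(X, A) →ₗ[A] A) {C₂ : ℝ}
    (hm₂ : ∀ φ : C(X, A), ‖m₂ φ‖ ≤ C₂ * ‖φ‖) (f : C(X, A)) :
    conv m₁ m₂ hm₂ f = m₁ (partialIntegral m₂ hm₂ f) := rfl

/-- `‖shift x f‖ ≤ ‖f‖`. -/
theorem norm_shift_le (x : X) (f : C(X, A)) : ‖shift x f‖ ≤ ‖f‖ :=
  (ContinuousMap.norm_le _ (norm_nonneg f)).2 fun y => by
    rw [shift_apply]; exact ContinuousMap.norm_coe_le_norm f _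

/-- `‖partialIntegral m₂ f‖ ≤ C₂ ‖f‖`. -/
theorem norm_partialIntegral_le (m₂ : C(X, A) →ₗ[A] A) {C₂ : ℝ} (hC₂ : 0 ≤ C₂)
    (hm₂ : ∀ φ : C(X, A), ‖m₂ φ‖ ≤ C₂ * ‖φ‖) (f : C(X, A)) :
    ‖partialIntegral m₂ hm₂ f‖ ≤ C₂ * ‖f‖ :=
  (ContinuousMap.norm_le _ (mul_nonneg hC₂ (norm_nonneg f))).2 fun x =>
    (hm₂ _).trans (mul_le_mul_of_nonneg_left (norm_shift_le x f) hC₂)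

/-- The convolution of measures bounded by `C₁`, `C₂` is bounded by `C₁ · C₂`. -/
theorem norm_conv_le (m₁ m₂ : C(X, A) →ₗ[A] A) {C₁ C₂ : ℝ} (hC₁ : 0 ≤ C₁) (hC₂ : 0 ≤ C₂)
    (hm₁ : ∀ φ : C(X, A), ‖m₁ φ‖ ≤ C₁ * ‖φ‖) (hm₂ : ∀ φ : C(X, A), ‖m₂ φ‖ ≤ C₂ * ‖φ‖)
    (f : C(X, A)) : ‖conv m₁ m₂ hm₂ f‖ ≤ (C₁ * C₂) * ‖f‖ := by
  rw [conv_apply, mul_assoc]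
  exact (hm₁ _).trans (mul_le_mul_of_nonneg_left (norm_partialIntegral_le m₂ hC₂ hm₂ f) hC₁)

end Shift

section LevelMul

variable {X : Type u} [MetricSpace X] (P : Presentation.{u, v} X) (A : Type*) [NormedCommRing A]
  [∀ k, AddCommGroup (P.F k)]

/-- The level-wise GROUP-RING product of two systems on the levels:
`(v ⋆ w) k c = Σ_{a ∈ F k} v k a · w k (c − a)` (`Σ_a v_a[a] · Σ_b w_b[b] = Σ_c (Σ_{a+b=c} v_a w_b)[c]`). -/
def levelMul (v w : ∀ k : ℕ, P.F k → A) : ∀ k : ℕ, P.F k → A :=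
  fun k c => ∑ a : P.F k, v k a * w k (c - a)

/-- `levelMul P A v w k c = Σ_a v k a * w k (c − a)`. -/
theorem levelMul_apply (v w : ∀ k : ℕ, P.F k → A) (k : ℕ) (c : P.F k) :
    levelMul P A v w k c = ∑ a : P.F k, v k a * w k (c - a) := rfl

/-- The group-ring product is commutative (reindex `a ↦ c − a`). -/
theorem levelMul_comm (v w : ∀ k : ℕ, P.F k → A) : levelMul P A v w = levelMul P A w v := by
  funext k c
  simp only [levelMul_apply]
  refine Fintype.sum_equiv (Equiv.subLeft c) _ _ fun a => ?_
  simp only [Equiv.subLeft_apply, sub_sub_cancel, mul_comm]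

end LevelMul

section Coord

variable {X : Type u} [NormedAddCommGroup X] (P : Presentation.{u, v} X)
variable {A : Type*} [NormedCommRing A] [∀ k, AddCommGroup (P.F k)]

/-- A translate of a fibre indicator is a fibre indicator, when the level map is additive:
`1_{fiber c}(x + ·) = 1_{fiber (c − q x)}`. -/
theorem shift_indicatorCM_fiber (hq : ∀ (k : ℕ) (x y : X), P.q k (x + y) = P.q k x + P.q k y)
    (x : X) (k : ℕ) (c : P.F k) :
    shift x (indicatorCM (P.fiber k c) : C(X, A)) = indicatorCM (P.fiber k (c - P.q k x)) := by
  ext y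
  rw [shift_apply, indicatorCM_apply (P.isClopen_fiber _ _), indicatorCM_apply (P.isClopen_fiber _ _)]
  have : x + y ∈ P.fiber k c ↔ y ∈ P.fiber k (c - P.q k x) := by
    simp only [Presentation.mem_fiber_iff, hq, eq_sub_iff_add_eq, add_comm]
  by_cases h : y ∈ P.fiber k (c - P.q k x)
  · rw [Set.indicator_of_mem (this.2 h), Set.indicator_of_mem h]
    rfl
  · rw [Set.indicator_of_notMem (fun h' => h (this.1 h')), Set.indicator_of_notMem h]

/-- Pointwise: `coord m₂ k (c − q k x) = Σ_a coord m₂ k (c − a) · 1_{fiber a}(x)`. -/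
theorem coord_sub_q_eq_sum (m₂ : C(X, A) →ₗ[A] A) (k : ℕ) (c : P.F k) (x : X) :
    P.coord m₂ k (c - P.q k x) =
      ∑ a : P.F k, P.coord m₂ k (c - a) * (P.fiber k a).indicator (1 : X → A) x := by
  rw [Finset.sum_eq_single (P.q k x)]
  · rw [Set.indicator_of_mem (P.mem_fiber_self k x), Pi.one_apply, mul_one]
  · intro a _ ha
    rw [P.indicator_fiber_of_ne (Ne.symm ha), mul_zero]
  · intro h
    exact absurd (Finset.mem_univ _) h

variable [CompactSpace X]

/-- The partial integral of a fibre indicator: `x ↦ m₂(1_{fiber c}(x + ·)) = Σ_a coord m₂ k (c − a) · 1_{fiber a}`. -/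
theorem partialIntegral_indicatorCM_fiber (hq : ∀ (k : ℕ) (x y : X), P.q k (x + y) = P.q k x + P.q k y)
    (m₂ : C(X, A) →ₗ[A] A) {C₂ : ℝ} (hm₂ : ∀ φ : C(X, A), ‖m₂ φ‖ ≤ C₂ * ‖φ‖) (k : ℕ) (c : P.F k) :
    partialIntegral m₂ hm₂ (indicatorCM (P.fiber k c)) =
      ∑ a : P.F k, P.coord m₂ k (c - a) • (indicatorCM (P.fiber k a) : C(X, A)) := by
  ext x
  rw [partialIntegral_apply, shift_indicatorCM_fiber P hq, ← Presentation.coord_apply,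
    coord_sub_q_eq_sum]
  simp only [ContinuousMap.coe_sum, Finset.sum_apply, ContinuousMap.smul_apply, smul_eq_mul,
    indicatorCM_apply (P.isClopen_fiber _ _)]

/-- THE COORDINATES OF A CONVOLUTION ARE THE GROUP-RING PRODUCTS OF THE COORDINATES:
`coord (m₁ ∗ m₂) k c = Σ_a coord m₁ k a · coord m₂ k (c − a)` — the product of `W[[Γ]]` read level
by level on `W[Γ/U_k]`. -/
theorem coord_conv (hq : ∀ (k : ℕ) (x y : X), P.q k (x + y) = P.q k x + P.q k y)
    (m₁ m₂ : C(X, A) →ₗ[A] A) {C₂ : ℝ} (hm₂ : ∀ φ : C(X, A), ‖m₂ φ‖ ≤ C₂ * ‖φ‖) :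
    P.coord (conv m₁ m₂ hm₂) = levelMul P A (P.coord m₁) (P.coord m₂) := by
  funext k c
  rw [Presentation.coord_apply, conv_apply, partialIntegral_indicatorCM_fiber P hq, map_sum,
    levelMul_apply]
  refine Finset.sum_congr rfl fun a _ => ?_
  rw [map_smul, smul_eq_mul, Presentation.coord_apply, Presentation.coord_apply]
  exact mul_comm _ _

end Coord

section Product

variable (p : ℕ) [Fact (Nat.Prime p)] (ι : Type*) [Fintype ι] [DecidableEq ι]

/-- The levels `(ℤ/p^k)^ι` of `padicProductPresentation p ι` are additive groups. -/
instance instAddCommGroupF (k : ℕ) : AddCommGroup ((padicProductPresentation p ι).F k) :=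
  inferInstanceAs (AddCommGroup (ι → ZMod (p ^ k)))

/-- The level maps of `padicProductPresentation p ι` are additive (`toZModPow k` is a ring hom). -/
theorem padicProductPresentation_q_add (k : ℕ) (x y : ι → ℤ_[p]) :
    (padicProductPresentation p ι).q k (x + y) =
      (padicProductPresentation p ι).q k x + (padicProductPresentation p ι).q k y := by
  funext i
  exact map_add (PadicInt.toZModPow k) (x i) (y i)

variable {A : Type*} [NormedCommRing A]

/-- On `Γ⁻ ≅ ℤ_p^ι`: the coordinates of `m₁ ∗ m₂` on `(ℤ/p^k)^ι = Γ⁻/p^kΓ⁻` are the group-ring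
products of the coordinates — the multiplication of `W[[Γ⁻]] = lim_k W[Γ⁻/p^kΓ⁻]` in the model. -/
theorem coord_conv_product (m₁ m₂ : C(ι → ℤ_[p], A) →ₗ[A] A) {C₂ : ℝ}
    (hm₂ : ∀ φ : C(ι → ℤ_[p], A), ‖m₂ φ‖ ≤ C₂ * ‖φ‖) :
    (padicProductPresentation p ι).coord (conv m₁ m₂ hm₂) =
      levelMul (padicProductPresentation p ι) A ((padicProductPresentation p ι).coord m₁)
        ((padicProductPresentation p ι).coord m₂) :=
  coord_conv (padicProductPresentation p ι) (padicProductPresentation_q_add p ι) m₁ m₂ hm₂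

end Product

/-! ## The point masses `δ_x` as the group-ring elements `[x]`; `δ_x ∗ δ_y = δ_{x+y}`, `δ_0` the unit -/
section Dirac

variable {X : Type u} [MetricSpace X] {A : Type*} [NormedCommRing A]

/-- The point mass `δ_x : f ↦ f x`. -/
def dirac (x : X) : C(X, A) →ₗ[A] A where
  toFun f := f x
  map_add' _ _ := rfl
  map_smul' _ _ := rfl

/-- `dirac x f = f x`. -/
@[simp] theorem dirac_apply (x : X) (f : C(X, A)) : dirac x f = f x := rfl

/-- `δ_x` is bounded by `1`. -/
theorem norm_dirac_le [CompactSpace X] (x : X) (f : C(X, A)) : ‖dirac x f‖ ≤ 1 * ‖f‖ := by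
  rw [dirac_apply, one_mul]
  exact ContinuousMap.norm_coe_le_norm f x

variable (P : Presentation.{u, v} X)

/-- THE COORDINATES OF A POINT MASS are the images of the point: `coord (δ_x) k a = [q k x = a]` —
the group-ring element `[q k x]` of `A[F k]` at every level. -/
theorem coord_dirac (x : X) (k : ℕ) (a : P.F k) :
    P.coord (dirac x : C(X, A) →ₗ[A] A) k a = if P.q k x = a then 1 else 0 := by
  rw [Presentation.coord_apply, dirac_apply, indicatorCM_apply (P.isClopen_fiber k a)]
  by_cases h : P.q k x = a
  · rw [Set.indicator_of_mem (show x ∈ P.fiber k a from h), if_pos h]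
    rfl
  · rw [Set.indicator_of_notMem (show x ∉ P.fiber k a from h), if_neg h]

/-- The coordinates of `δ_x` are those of the group-ring element `[x]`: `1` at `q k x`, `0`
elsewhere (the function form). -/
theorem coord_dirac_eq (x : X) (k : ℕ) :
    P.coord (dirac x : C(X, A) →ₗ[A] A) k = fun a => if P.q k x = a then 1 else 0 :=
  funext fun a => coord_dirac P x k a

end Dirac

section Conv

variable {X : Type u} [NormedAddCommGroup X] [CompactSpace X] {A : Type*} [NormedCommRing A]

/-- The partial integral against `δ_y` is the translate by `y`. -/
theorem partialIntegral_dirac (y : X) (f : C(X, A)) :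
    partialIntegral (dirac y) (norm_dirac_le y) f = ⟨fun x => f (x + y), f.continuous.comp (continuous_id.add continuous_const)⟩ := by
  ext x
  rw [partialIntegral_apply, dirac_apply, shift_apply]
  rfl

/-- THE GROUP LAW: `δ_x ∗ δ_y = δ_{x + y}`. -/
theorem conv_dirac (x y : X) :
    conv (dirac x : C(X, A) →ₗ[A] A) (dirac y) (norm_dirac_le y) = dirac (x + y) := by
  ext f
  rw [conv_apply, partialIntegral_dirac, dirac_apply, dirac_apply]
  rfl

/-- THE UNIT: `δ_0 ∗ m = m` for every measure `m`. -/
theorem conv_dirac_zero (m : C(X, A) →ₗ[A] A) {C : ℝ} (hm : ∀ φ : C(X, A), ‖m φ‖ ≤ C * ‖φ‖) :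
    conv (dirac 0) m hm = m := by
  ext f
  rw [conv_apply, dirac_apply, partialIntegral_apply]
  congr 1
  ext y
  rw [shift_apply, zero_add]

/-- `m ∗ δ_0 = m` as well (the convolution is symmetric on coordinates; here directly:
`∫ f(x + 0) dm(x) = m(f)`). -/
theorem conv_dirac_zero' (m : C(X, A) →ₗ[A] A) :
    conv m (dirac 0 : C(X, A) →ₗ[A] A) (norm_dirac_le 0) = m := by
  ext f
  rw [conv_apply, partialIntegral_dirac]
  congr 1
  ext x
  simp only [ContinuousMap.coe_mk, add_zero]

variable (P : Presentation.{u, v} X) [∀ k, AddCommGroup (P.F k)]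

/-- `[x + y] = [x] ⋆ [y]` level by level: the group-ring law of `lim_k A[F k]`, obtained from the
group law of the point masses through `coord_conv`. -/
theorem coord_dirac_add (hq : ∀ (k : ℕ) (x y : X), P.q k (x + y) = P.q k x + P.q k y) (x y : X) :
    P.coord (dirac (x + y) : C(X, A) →ₗ[A] A) =
      levelMul P A (P.coord (dirac x)) (P.coord (dirac y)) := by
  rw [← conv_dirac (A := A) x y, coord_conv P hq]

end Conv

end Summit.Ventures.HodgeRepro2.T5ProfiniteDistributionConvolution
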